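import Mathlib
import Literature.AlgebraicGeometry.Resolution.CobordantChartPlaneSlice
import Literature.AlgebraicGeometry.Resolution.WeightedShear
import Summits.ResolutionOfSingularities.ResolutionOfSingularities.Theorems.WeightedInvariantGlobalizeLocalDropCanonize
import Summits.ResolutionOfSingularities.ResolutionOfSingularities.Theorems.WeightedInvariantGlobalizeLocalDropCylinder

/-!
# `WeightedInvariant.LocalWeightedDrop`, line `hasse-ridge-face-selection`: the plane branch drop
# from the non-normal-crossing count (bookkeeping)

Crux item stmt-ResolutionOfSingularities-8899 (route `ResolutionOfSingularities/WeightedInvariant`),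
skeleton v9 of the line, stub `stub_planeBranchDrop_of_count`.  HYPOTHESIS (the classical input, a
neighbouring stub): a count `ν : k[[y₀,y₁]] → ℕ` with (i) `ν b = 0` iff `b` has NORMAL-CROSSING SUPPORT
(`b∘Φ = u·y₀ᵃ·y₁ᶜ`, `Φ` a legal formal coordinate change, `u` a unit), (ii) `ν` monotone along
divisibility, (iii) at a germ without nc support every exceptional point `c ≠ 0` of the point blow-up
has a slot `i`, `cᵢ ≠ 0`, whose slice `s·G|_{yᵢ'=0}` has smaller `ν`.  CONCLUSION: the rank
`κ b := ω·ν b + ord b` (`κ 0 := 0`) drops along the plane branch game of `stub_doublePointLiftPlane`: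
* `ν b > 0`: play `(id, (1,1))`; the counted successor `S = s^{a mod 2}·G|` divides `s·G|`, so
  `ν S ≤ ν(s·G|) < ν b` by (ii), (iii), and `κ S < ω·(ν S + 1) ≤ κ b` (or `S = 0`, `κ S = 0 < κ b`).
* `ν b = 0`, `b∘Φ = u·y₀ᵃ·y₁ᶜ`, `a + c = ord b ≥ 2`, after a coordinate swap `c ≤ a`.  If `a ≥ 2`
  play `(Φ, (1,0))`: the transform is `sᵃ·U·(c₀ + y₀')ᵃ·y₁'ᶜ`, so (uniqueness of the `s`-adic
  factorisation) the slot-`0` successor is `S = u'·s^{a mod 2}·vᶜ`: nc support, `ν S = 0`, order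
  `a mod 2 + c < a + c`.  If `a = c = 1` play `(Φ, (1,1))`: the transform is
  `s²·U·(c₀ + y₀')(c₁ + y₁')`, `a' = ord = 2`, and every slice `U|·cᵢ·(cⱼ + v)` has order `≤ 1`.
-/

set_option linter.dupNamespace false -- mandated namespace of this single-conjunct summit

namespace Summit.ResolutionOfSingularities.ResolutionOfSingularities.Theorems

open Literature.AlgebraicGeometry.Resolution

namespace PlaneBranchDropOfCount

open MvPowerSeries

variable {k : Type} [Field k]

/-- Lexicographic comparison of `ω·n + e`, first component. -/
theorem omega_mul_add_lt {n n' : ℕ} (e e' : ℕ) (h : n < n') :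
    Ordinal.omega0 * (n : Ordinal.{0}) + (e : Ordinal.{0}) <
      Ordinal.omega0 * (n' : Ordinal.{0}) + (e' : Ordinal.{0}) :=
  calc Ordinal.omega0 * (n : Ordinal.{0}) + (e : Ordinal.{0})
      < Ordinal.omega0 * (n : Ordinal.{0}) + Ordinal.omega0 :=
        (add_lt_add_iff_left _).mpr (Ordinal.natCast_lt_omega0 e)
    _ = Ordinal.omega0 * ((n + 1 : ℕ) : Ordinal.{0}) := by rw [Nat.cast_succ, mul_add_one]
    _ ≤ Ordinal.omega0 * (n' : Ordinal.{0}) := mul_le_mul_right (by exact_mod_cast h) _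
    _ ≤ _ := le_self_add

/-! ### Slices (adapted from work/stubs/PlaneBranchDropMoves.lean, worker S3, 2026-08-16) -/

/-- The slice at slot `i` keeps the exceptional variable: `s ↦ s`. -/
theorem subst_slice_X_zero (i : Fin 2) :
    subst (fun j : Fin 3 => if j = i.succ then (0 : MvPowerSeries (Fin 2) k)
      else X (Fin.predAbove i j)) (X (0 : Fin 3) : MvPowerSeries (Fin 3) k) = X (0 : Fin 2) := by
  -- adapted from work/stubs/PlaneBranchDropMoves.lean (worker S3, 2026-08-16)
  rw [subst_X (CobordantChartPlaneSlice.hasSubst_slice (R := k) i),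
    if_neg (Fin.succ_ne_zero i).symm]
  have h0 : Fin.predAbove i (0 : Fin 3) = 0 := by fin_cases i <;> decide
  rw [h0]

/-- The slice at slot `i` kills its own variable: `y_i' ↦ 0`. -/
theorem subst_slice_X_succ_self (i : Fin 2) :
    subst (fun j : Fin 3 => if j = i.succ then (0 : MvPowerSeries (Fin 2) k)
      else X (Fin.predAbove i j)) (X i.succ : MvPowerSeries (Fin 3) k) = 0 := by
  rw [subst_X (CobordantChartPlaneSlice.hasSubst_slice (R := k) i), if_pos rfl]

/-- The slice at slot `i` sends the other variable `y_j'` (`j ≠ i`) to `v = X 1`. -/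
theorem subst_slice_X_succ_of_ne {i j : Fin 2} (hji : j ≠ i) :
    subst (fun l : Fin 3 => if l = i.succ then (0 : MvPowerSeries (Fin 2) k)
      else X (Fin.predAbove i l)) (X j.succ : MvPowerSeries (Fin 3) k) = X (1 : Fin 2) := by
  rw [subst_X (CobordantChartPlaneSlice.hasSubst_slice (R := k) i),
    if_neg fun h => hji (Fin.succ_injective _ h)]
  have h1 : Fin.predAbove i j.succ = 1 := by
    fin_cases i <;> fin_cases j <;> first | decide | exact absurd rfl hji
  rw [h1]

/-- The slice commutes with the parity twist: `(sᵐ · G)|_{y_i' = 0} = sᵐ · G|_{y_i' = 0}`. -/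
theorem subst_slice_X_pow_mul (i : Fin 2) (m : ℕ) (G : MvPowerSeries (Fin 3) k) :
    subst (fun j : Fin 3 => if j = i.succ then (0 : MvPowerSeries (Fin 2) k)
      else X (Fin.predAbove i j)) (X 0 ^ m * G) =
      X 0 ^ m * subst (fun j : Fin 3 => if j = i.succ then
        (0 : MvPowerSeries (Fin 2) k) else X (Fin.predAbove i j)) G := by
  rw [subst_mul (CobordantChartPlaneSlice.hasSubst_slice (R := k) i),
    subst_pow (CobordantChartPlaneSlice.hasSubst_slice (R := k) i), subst_slice_X_zero]

/-- The slice family has zero constant terms. -/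
theorem constantCoeff_slice (i : Fin 2) (j : Fin 3) :
    constantCoeff ((fun l : Fin 3 => if l = i.succ then (0 : MvPowerSeries (Fin 2) k)
      else X (Fin.predAbove i l)) j) = 0 := by
  dsimp only
  split_ifs <;> simp [constantCoeff_X]

/-- `ord (u · y₀ᵃ · y₁ᶜ) = a + c` for a unit `u`. -/
theorem order_unit_monomial {u : MvPowerSeries (Fin 2) k} (hu : constantCoeff u ≠ 0) (a c : ℕ) :
    (u * X 0 ^ a * X 1 ^ c).order = ((a + c : ℕ) : ℕ∞) := by
  have hu0 : u.order = 0 := by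
    by_contra h
    exact hu (order_ne_zero_iff_constCoeff_eq_zero.mp h)
  rw [order_mul, order_mul, hu0, zero_add, X_pow_eq, X_pow_eq, order_monomial_of_ne_zero one_ne_zero,
    order_monomial_of_ne_zero one_ne_zero, Finsupp.degree_single, Finsupp.degree_single, Nat.cast_add]

/-- The identity coordinate change has invertible linear part. -/
theorem isUnit_det_X :
    IsUnit (Matrix.det (Matrix.of fun i j =>
      coeff (Finsupp.single j 1) (X i : MvPowerSeries (Fin 2) k))) := by
  rw [Matrix.det_fin_two]
  simp [coeff_index_single_X]

/-- THE COORDINATE SWAP: an nc presentation `b∘Φ = u·y₀ᵃ·y₁ᶜ` gives one with the exponents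
exchanged. -/
theorem swap_presentation {b u : MvPowerSeries (Fin 2) k} {Φ : Fin 2 → MvPowerSeries (Fin 2) k}
    {a c : ℕ} (hΦ0 : ∀ i, constantCoeff (Φ i) = 0)
    (hdet : IsUnit (Matrix.det (Matrix.of fun i j => coeff (Finsupp.single j 1) (Φ i))))
    (hu : constantCoeff u ≠ 0) (hfac : subst Φ b = u * X 0 ^ a * X 1 ^ c) :
    ∃ (Φ' : Fin 2 → MvPowerSeries (Fin 2) k) (u' : MvPowerSeries (Fin 2) k),
      (∀ i, constantCoeff (Φ' i) = 0) ∧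
      IsUnit (Matrix.det (Matrix.of fun i j => coeff (Finsupp.single j 1) (Φ' i))) ∧
      constantCoeff u' ≠ 0 ∧ subst Φ' b = u' * X 0 ^ c * X 1 ^ a := by
  have hσ0 : ∀ i, constantCoeff ((![X 1, X 0] : Fin 2 → MvPowerSeries (Fin 2) k) i) = 0 := by
    intro i
    fin_cases i <;> simp [constantCoeff_X]
  have hσs : HasSubst (![X 1, X 0] : Fin 2 → MvPowerSeries (Fin 2) k) := HasSubst.X_X
  refine ⟨fun i => subst ![X 1, X 0] (Φ i), subst ![X 1, X 0] u,
    constantCoeff_comp_eq_zero hΦ0 hσ0, ?_, ?_, ?_⟩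
  · change IsUnit (FormalCoordChange.linMat (fun i => subst ![X 1, X 0] (Φ i))).det
    rw [linMat_comp Φ hσ0, Matrix.det_mul]
    refine hdet.mul ?_
    rw [Matrix.det_fin_two]
    simp [FormalCoordChange.linMat, coeff_index_single_X]
  · rw [constantCoeff_subst_of_constantCoeff_zero _ hσ0]
    exact hu
  · rw [← subst_subst_eq_subst_comp hΦ0 hσ0, hfac, subst_mul hσs, subst_mul hσs, subst_pow hσs,
      subst_pow hσs, subst_X hσs, subst_X hσs]
    simp only [Matrix.cons_val_zero, Matrix.cons_val_one]
    ring

/-! ### The three moves -/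

/-- CASE `ν b > 0` — THE POINT BLOW-UP `(id, (1,1))`: at every exceptional point the slot provided
by the count hypothesis has, for the parity-twisted slice `S = s^{a mod 2}·G|`, either `S = 0` or
`ν S ≤ ν (s·G|) < ν b`. -/
theorem blowup_clause (ν : MvPowerSeries (Fin 2) k → ℕ)
    (hν2 : ∀ b d : MvPowerSeries (Fin 2) k, d ≠ 0 → b ∣ d → ν b ≤ ν d)
    {b : MvPowerSeries (Fin 2) k}
    (h3 : ∀ c : Fin 2 → k, c ≠ 0 → ∀ (a : ℕ) (G : MvPowerSeries (Fin 3) k),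
      subst (CobordantChart.chart (fun _ : Fin 2 => 1) c) b = X 0 ^ a * G →
      ¬ (X (0 : Fin 3) ∣ G) →
      ∃ i : Fin 2, c i ≠ 0 ∧
        ν (X 0 * subst (fun j : Fin 3 => if j = i.succ then (0 : MvPowerSeries (Fin 2) k)
          else X (Fin.predAbove i j)) G) < ν b)
    (c : Fin 2 → k) (hc0 : c ≠ 0) (a : ℕ) (G : MvPowerSeries (Fin 3) k)
    (hfac : subst (CobordantChart.chart (fun _ : Fin 2 => 1) c)
      (subst (X : Fin 2 → MvPowerSeries (Fin 2) k) b) = X 0 ^ a * G)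
    (hG : ¬ X (0 : Fin 3) ∣ G) :
    ∃ i : Fin 2, c i ≠ 0 ∧ ∀ S : MvPowerSeries (Fin 2) k,
      S = subst (fun j : Fin 3 => if j = i.succ then (0 : MvPowerSeries (Fin 2) k)
        else X (Fin.predAbove i j)) (X 0 ^ (a % 2) * G) → S ≠ 0 → ν S < ν b := by
  rw [subst_self, id] at hfac
  obtain ⟨i, hci, hlt⟩ := h3 c hc0 a G hfac hG
  refine ⟨i, hci, fun S hS hS0 => lt_of_le_of_lt (hν2 S _ (mul_ne_zero (FormalCoordChange.X_ne_zero' _) ?_) ?_) hlt⟩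
  · rintro h
    rw [subst_slice_X_pow_mul, h, mul_zero] at hS
    exact hS0 hS
  · rw [hS, subst_slice_X_pow_mul]
    rcases Nat.mod_two_eq_zero_or_one a with h | h
    · rw [h, pow_zero, one_mul]
      exact dvd_mul_left _ _
    · rw [h, pow_one]

/-- CASE `b∘Φ = u·y₀ᵃ·y₁ᵉ` — THE DIVISORIAL MOVE `(Φ, (1,0))`: at its exceptional points
`c = (c₀, 0)`, `c₀ ≠ 0`, and for every factorisation `b∘Φ(chart) = s^{a'}·G`, `s ∤ G`, one has
`a' = a` and the slot-`0` successor is `S = u'·s^{a mod 2}·vᵉ` with `u'(0) ≠ 0`. -/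
theorem divisorial_clause (a e : ℕ) {u : MvPowerSeries (Fin 2) k} (hu : constantCoeff u ≠ 0)
    (c : Fin 2 → k) (hc : ∀ i, (![1, 0] : Fin 2 → ℕ) i = 0 → c i = 0) (hc0 : c ≠ 0)
    (a' : ℕ) (G : MvPowerSeries (Fin 3) k)
    (hfac : subst (CobordantChart.chart ![1, 0] c) (u * X 0 ^ a * X 1 ^ e) = X 0 ^ a' * G)
    (hG : ¬ X (0 : Fin 3) ∣ G) :
    c 0 ≠ 0 ∧ a = a' ∧ ∃ u' : MvPowerSeries (Fin 2) k, constantCoeff u' ≠ 0 ∧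
      subst (fun j : Fin 3 => if j = (0 : Fin 2).succ then (0 : MvPowerSeries (Fin 2) k)
        else X (Fin.predAbove (0 : Fin 2) j)) (X 0 ^ (a' % 2) * G) =
        u' * X 0 ^ (a % 2) * X 1 ^ e := by
  have hc1 : c 1 = 0 := hc 1 rfl
  have hc0' : c 0 ≠ 0 := fun h => hc0 (funext fun i => by fin_cases i <;> assumption)
  have hchs := CobordantChart.hasSubst_chart ![1, 0] c hc
  have hU0 : constantCoeff (subst (CobordantChart.chart ![1, 0] c) u) ≠ 0 := by
    rw [constantCoeff_subst_of_constantCoeff_zero _ (CobordantArc.constantCoeff_chart ![1, 0] c hc)]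
    exact hu
  -- the `s`-adic factorisation of the transform, by hand
  have hfacH : subst (CobordantChart.chart ![1, 0] c) (u * X 0 ^ a * X 1 ^ e) =
      X 0 ^ a * (subst (CobordantChart.chart ![1, 0] c) u *
        (C (c 0) + X (0 : Fin 2).succ) ^ a * X (1 : Fin 2).succ ^ e) := by
    rw [subst_mul hchs, subst_mul hchs, subst_pow hchs, subst_pow hchs, subst_X hchs, subst_X hchs,
      CobordantChart.chart_apply, CobordantChart.chart_apply, hc1, map_zero, zero_add]
    simp only [Matrix.cons_val_zero, Matrix.cons_val_one, pow_one, pow_zero, one_mul, mul_pow]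
    ring
  have hH : ¬ X (0 : Fin 3) ∣ subst (CobordantChart.chart ![1, 0] c) u *
      (C (c 0) + X (0 : Fin 2).succ) ^ a * X (1 : Fin 2).succ ^ e := by
    rw [X_dvd_iff]
    intro h
    have h1 := h (Finsupp.single (1 : Fin 2).succ e) (by simp)
    rw [X_pow_eq, coeff_mul_monomial, if_pos le_rfl, tsub_self, mul_one,
      coeff_zero_eq_constantCoeff_apply, map_mul, map_pow, map_add, constantCoeff_C,
      constantCoeff_X, add_zero] at h1
    exact mul_ne_zero hU0 (pow_ne_zero a hc0') h1
  obtain ⟨haa, hHG⟩ := X_pow_mul_eq_X_pow_mul 0 (hfacH.symm.trans hfac) hH hG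
  have hsl := CobordantChartPlaneSlice.hasSubst_slice (R := k) (n := 2) 0
  refine ⟨hc0', haa, subst (fun j : Fin 3 => if j = (0 : Fin 2).succ then
      (0 : MvPowerSeries (Fin 2) k) else X (Fin.predAbove (0 : Fin 2) j))
      (subst (CobordantChart.chart ![1, 0] c) u) * C (c 0) ^ a, ?_, ?_⟩
  · rw [map_mul, map_pow, constantCoeff_C,
      constantCoeff_subst_of_constantCoeff_zero _ (constantCoeff_slice 0)]
    exact mul_ne_zero hU0 (pow_ne_zero a hc0')
  · rw [← hHG, ← haa, subst_slice_X_pow_mul, subst_mul hsl, subst_mul hsl, subst_pow hsl,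
      subst_pow hsl, subst_add hsl, subst_C, subst_slice_X_succ_self,
      subst_slice_X_succ_of_ne (show (1 : Fin 2) ≠ 0 from one_ne_zero), add_zero]
    ring

/-- `ord (V · (r + v)) ≤ 1` for a unit `V`: such a germ is never counted. -/
theorem not_mem_msq_unit_mul_linear {V : MvPowerSeries (Fin 2) k} (hV : constantCoeff V ≠ 0)
    (r : k) {S : MvPowerSeries (Fin 2) k} (hS : S = V * (C r + X 1)) :
    ¬ (constantCoeff S = 0 ∧ ∀ j, coeff (Finsupp.single j 1) S = 0) := by
  intro hSm
  have h2 := (FormalCoordChange.two_le_order_iff S).mpr hSm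
  have hV0 : V.order = 0 := by
    by_contra h
    exact hV (order_ne_zero_iff_constCoeff_eq_zero.mp h)
  have hL : (C r + X 1 : MvPowerSeries (Fin 2) k).order ≤ 1 := by
    have h := order_le (f := (C r + X 1 : MvPowerSeries (Fin 2) k)) (d := Finsupp.single 1 1)
      (by simp [coeff_C])
    simpa using h
  rw [hS, order_mul, hV0, zero_add] at h2
  exact absurd (h2.trans hL) (by decide)

/-- CASE `b∘Φ = u·y₀·y₁` — THE POINT BLOW-UP `(Φ, (1,1))` HAS NO COUNTED SUCCESSOR: for every
exceptional point `c`, every factorisation `b∘Φ(chart) = s^{a'}·G`, `s ∤ G`, and every slot `i`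
with `cᵢ ≠ 0`, the parity-twisted slice `S = U|·cᵢ·(cⱼ + v)` is not in `𝔪²`. -/
theorem nodal_clause {u : MvPowerSeries (Fin 2) k} (hu : constantCoeff u ≠ 0)
    (c : Fin 2 → k) (hc : ∀ i, (fun _ : Fin 2 => (1 : ℕ)) i = 0 → c i = 0)
    (a' : ℕ) (G : MvPowerSeries (Fin 3) k)
    (hfac : subst (CobordantChart.chart (fun _ : Fin 2 => 1) c) (u * X 0 ^ 1 * X 1 ^ 1) =
      X 0 ^ a' * G)
    (hG : ¬ X (0 : Fin 3) ∣ G) {i j : Fin 2} (hji : j ≠ i) (hci : c i ≠ 0)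
    (S : MvPowerSeries (Fin 2) k)
    (hS : S = subst (fun l : Fin 3 => if l = i.succ then (0 : MvPowerSeries (Fin 2) k)
        else X (Fin.predAbove i l)) (X 0 ^ (a' % 2) * G)) :
    ¬ (constantCoeff S = 0 ∧ ∀ j, coeff (Finsupp.single j 1) S = 0) := by
  have hchs := CobordantChart.hasSubst_chart (fun _ : Fin 2 => 1) c hc
  have hU0 : constantCoeff (subst (CobordantChart.chart (fun _ : Fin 2 => 1) c) u) ≠ 0 := by
    rw [constantCoeff_subst_of_constantCoeff_zero _
      (CobordantArc.constantCoeff_chart (fun _ : Fin 2 => 1) c hc)]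
    exact hu
  have hF0 : u * X 0 ^ 1 * X 1 ^ 1 ≠ (0 : MvPowerSeries (Fin 2) k) := by
    refine mul_ne_zero (mul_ne_zero ?_ (pow_ne_zero _ (FormalCoordChange.X_ne_zero' _)))
      (pow_ne_zero _ (FormalCoordChange.X_ne_zero' _))
    rintro rfl
    exact hu (map_zero _)
  -- `a' = ord (u·y₀·y₁) = 2`
  have ha' : a' = 2 := by
    have h : (a' : ℕ∞) = (u * X 0 ^ 1 * X 1 ^ 1).order :=
      CobordantChart.eq_weightedOrder_of_factor (fun _ : Fin 2 => 1) c hc hF0 hfac hG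
    rw [order_unit_monomial hu] at h
    exact_mod_cast h
  subst ha'
  -- the transform by hand: `s²·U·(cᵢ + yᵢ')(cⱼ + yⱼ')`
  have hX : (X 0 : MvPowerSeries (Fin 2) k) ^ 1 * X 1 ^ 1 = X i * X j := by
    fin_cases i <;> fin_cases j <;> first | exact absurd rfl hji | simp [mul_comm]
  rw [mul_assoc, hX, subst_mul hchs, subst_mul hchs, subst_X hchs, subst_X hchs,
    CobordantChart.chart_apply, CobordantChart.chart_apply, pow_one] at hfac
  have hGeq : G = subst (CobordantChart.chart (fun _ : Fin 2 => 1) c) u *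
      ((C (c i) + X i.succ) * (C (c j) + X j.succ)) := by
    refine mul_left_cancel₀ (pow_ne_zero 2 (FormalCoordChange.X_ne_zero' (0 : Fin 3))) ?_
    rw [← hfac]
    ring
  have hsl := CobordantChartPlaneSlice.hasSubst_slice (R := k) (n := 2) i
  rw [subst_slice_X_pow_mul, hGeq, subst_mul hsl, subst_mul hsl, subst_add hsl, subst_add hsl,
    subst_C, subst_C, subst_slice_X_succ_self, subst_slice_X_succ_of_ne hji, add_zero] at hS
  refine not_mem_msq_unit_mul_linear (V := subst (fun l : Fin 3 => if l = i.succ then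
      (0 : MvPowerSeries (Fin 2) k) else X (Fin.predAbove i l))
      (subst (CobordantChart.chart (fun _ : Fin 2 => 1) c) u) * C (c i)) ?_ (c j) ?_
  · rw [map_mul, constantCoeff_C, constantCoeff_subst_of_constantCoeff_zero _ (constantCoeff_slice i)]
    exact mul_ne_zero hU0 hci
  · rw [hS]
    simp only [Nat.reduceMod, pow_zero, one_mul]
    ring

end PlaneBranchDropOfCount

open PlaneBranchDropOfCount in
/-- FROM THE NON-NORMAL-CROSSING COUNT TO THE PLANE BRANCH DROP (bookkeeping; stub
`stub_planeBranchDrop_of_count` of the line `hasse-ridge-face-selection`, crux `LocalWeightedDrop`,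
stmt-ResolutionOfSingularities-8899).  Given a count `ν` of the non-normal-crossing infinitely near
points (zero exactly on germs of normal-crossing support, monotone along divisibility, dropping at some
tame slot of every exceptional point of the point blow-up of a non-nc germ), the rank
`κ b = ω·ν b + ord b` (`κ 0 = 0`) drops along the plane branch game: blow up the point while `ν > 0`;
on `u·y₀ᵃ·y₁ᶜ` (after a swap `c ≤ a`) blow up the divisor `y₀ = 0` if `a ≥ 2` (successor
`u'·y₀^{a mod 2}·y₁ᶜ`), and the point if `a = c = 1` (no counted successor). -/
theorem stub_planeBranchDrop_of_count : ∀ (k : Type) [Field k] [IsAlgClosed k],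
    (∃ ν : MvPowerSeries (Fin 2) k → ℕ,
      (∀ b : MvPowerSeries (Fin 2) k, b ≠ 0 → (ν b = 0 ↔
        (∃ (Φ : Fin 2 → MvPowerSeries (Fin 2) k) (u : MvPowerSeries (Fin 2) k) (a c : ℕ),
          (∀ i, MvPowerSeries.constantCoeff (Φ i) = 0) ∧
          IsUnit (Matrix.det (Matrix.of fun i j => MvPowerSeries.coeff (Finsupp.single j 1) (Φ i))) ∧
          MvPowerSeries.constantCoeff u ≠ 0 ∧ MvPowerSeries.subst Φ b = u * MvPowerSeries.X 0 ^ a * MvPowerSeries.X 1 ^ c))) ∧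
      (∀ b d : MvPowerSeries (Fin 2) k, d ≠ 0 → b ∣ d → ν b ≤ ν d) ∧
      (∀ b : MvPowerSeries (Fin 2) k, b ≠ 0 →
        ¬ (∃ (Φ : Fin 2 → MvPowerSeries (Fin 2) k) (u : MvPowerSeries (Fin 2) k) (a c : ℕ),
          (∀ i, MvPowerSeries.constantCoeff (Φ i) = 0) ∧
          IsUnit (Matrix.det (Matrix.of fun i j => MvPowerSeries.coeff (Finsupp.single j 1) (Φ i))) ∧
          MvPowerSeries.constantCoeff u ≠ 0 ∧ MvPowerSeries.subst Φ b = u * MvPowerSeries.X 0 ^ a * MvPowerSeries.X 1 ^ c) →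
        ∀ c : Fin 2 → k, c ≠ 0 → ∀ (a : ℕ) (G : MvPowerSeries (Fin 3) k),
          MvPowerSeries.subst (CobordantChart.chart (fun _ : Fin 2 => 1) c) b = MvPowerSeries.X 0 ^ a * G →
          ¬ (MvPowerSeries.X (0 : Fin 3) ∣ G) →
          ∃ i : Fin 2, c i ≠ 0 ∧
            ν (MvPowerSeries.X 0 * MvPowerSeries.subst (fun j : Fin 3 => if j = i.succ then (0 : MvPowerSeries (Fin 2) k)
                  else MvPowerSeries.X (Fin.predAbove i j)) G) < ν b)) →
    ∃ κ : MvPowerSeries (Fin 2) k → Ordinal.{0}, ∀ b : MvPowerSeries (Fin 2) k, b ≠ 0 →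
      (MvPowerSeries.constantCoeff b = 0 ∧ ∀ j, MvPowerSeries.coeff (Finsupp.single j 1) b = 0) →
      ∃ (Φ : Fin 2 → MvPowerSeries (Fin 2) k) (w : Fin 2 → ℕ),
        (∀ i, MvPowerSeries.constantCoeff (Φ i) = 0) ∧
        IsUnit (Matrix.det (Matrix.of fun i j => MvPowerSeries.coeff (Finsupp.single j 1) (Φ i))) ∧
        (∀ i, w i ≤ 1) ∧ (∃ i, 0 < w i) ∧
        ∀ (c : Fin 2 → k), (∀ i, w i = 0 → c i = 0) → c ≠ 0 →
        ∀ (a : ℕ) (G : MvPowerSeries (Fin 3) k),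
          MvPowerSeries.subst (CobordantChart.chart w c) (MvPowerSeries.subst Φ b) = MvPowerSeries.X 0 ^ a * G →
          ¬ (MvPowerSeries.X (0 : Fin 3) ∣ G) →
          ∃ i : Fin 2, c i ≠ 0 ∧ ∀ S : MvPowerSeries (Fin 2) k,
            S = MvPowerSeries.subst (fun j : Fin 3 => if j = i.succ then (0 : MvPowerSeries (Fin 2) k)
                  else MvPowerSeries.X (Fin.predAbove i j)) (MvPowerSeries.X 0 ^ (a % 2) * G) →
            (MvPowerSeries.constantCoeff S = 0 ∧ ∀ j, MvPowerSeries.coeff (Finsupp.single j 1) S = 0) →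
            κ S < κ b := by
  intro k _ _ hN
  obtain ⟨ν, hν1, hν2, hν3⟩ := hN
  classical
  refine ⟨fun b => if b = 0 then 0 else
    Ordinal.omega0 * (ν b : Ordinal.{0}) + ((b.order.toNat : ℕ) : Ordinal.{0}), ?_⟩
  intro b hb0 hbm
  by_cases hνb : ν b = 0
  · -- normal-crossing support `b∘Φ = u·y₀ᵃ·y₁ᶜ`
    obtain ⟨Φ, u, a, c, hΦ0, hdet, hu, hfac⟩ := (hν1 b hb0).mp hνb
    wlog hca : c ≤ a generalizing Φ u a c with H
    · obtain ⟨Φ', u', hΦ'0, hdet', hu', hfac'⟩ := swap_presentation hΦ0 hdet hu hfac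
      exact H Φ' u' c a hΦ'0 hdet' hu' hfac' (not_le.mp hca).le
    have hordb : b.order = ((a + c : ℕ) : ℕ∞) := by
      rw [← WeightedShear.order_subst_of_isUnit_det hΦ0 hdet b, hfac, order_unit_monomial hu]
    have hac : 2 ≤ a + c := by
      have h2 := (FormalCoordChange.two_le_order_iff b).mpr hbm
      rw [hordb] at h2
      exact_mod_cast h2
    rcases (show 2 ≤ a ∨ (a = 1 ∧ c = 1) by omega) with ha2 | ⟨rfl, rfl⟩
    · -- `a ≥ 2`: the divisorial move `(Φ, (1, 0))`
      refine ⟨Φ, ![1, 0], hΦ0, hdet, fun i => by fin_cases i <;> simp, ⟨0, Nat.one_pos⟩, ?_⟩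
      intro c' hc' hc'0 a' G hfac' hG
      rw [hfac] at hfac'
      obtain ⟨hc'0', -, u', hu', hS⟩ := divisorial_clause a c hu c' hc' hc'0 a' G hfac' hG
      refine ⟨0, hc'0', fun S hSdef _ => ?_⟩
      rw [hS] at hSdef
      have hS0 : S ≠ 0 := by
        rw [hSdef]
        exact mul_ne_zero (mul_ne_zero (fun h => hu' (by rw [h, map_zero]))
          (pow_ne_zero _ (FormalCoordChange.X_ne_zero' _)))
          (pow_ne_zero _ (FormalCoordChange.X_ne_zero' _))
      have hνS : ν S = 0 := (hν1 S hS0).mpr ⟨MvPowerSeries.X, u', a % 2, c,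
        fun i => MvPowerSeries.constantCoeff_X i, isUnit_det_X, hu', by
          rw [MvPowerSeries.subst_self, id, hSdef]⟩
      have hordS : S.order = ((a % 2 + c : ℕ) : ℕ∞) := by rw [hSdef, order_unit_monomial hu']
      dsimp only
      rw [if_neg hS0, if_neg hb0, hνS, hνb, hordS, hordb, ENat.toNat_coe, ENat.toNat_coe]
      exact (add_lt_add_iff_left _).mpr (by exact_mod_cast (show a % 2 + c < a + c by omega))
    · -- `a = c = 1`: the point blow-up `(Φ, (1, 1))` has no counted successor
      refine ⟨Φ, fun _ => 1, hΦ0, hdet, fun _ => le_rfl, ⟨0, Nat.one_pos⟩, ?_⟩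
      intro c' hc' hc'0 a' G hfac' hG
      rw [hfac] at hfac'
      obtain ⟨i, hci⟩ : ∃ i, c' i ≠ 0 := by
        by_contra h
        push Not at h
        exact hc'0 (funext h)
      obtain ⟨j, hji⟩ : ∃ j : Fin 2, j ≠ i := ⟨i + 1, by fin_cases i <;> decide⟩
      exact ⟨i, hci, fun S hSdef hSm =>
        absurd hSm (nodal_clause hu c' hc' a' G hfac' hG hji hci S hSdef)⟩
  · -- no normal-crossing support: the point blow-up `(id, (1, 1))`, `ν` drops
    have hNC := fun h => hνb ((hν1 b hb0).mpr h)
    refine ⟨MvPowerSeries.X, fun _ => 1, fun i => MvPowerSeries.constantCoeff_X i, isUnit_det_X,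
      fun _ => le_rfl, ⟨0, Nat.one_pos⟩, ?_⟩
    intro c' _ hc'0 a' G hfac' hG
    obtain ⟨i, hci, hS⟩ := blowup_clause ν hν2 (hν3 b hb0 hNC) c' hc'0 a' G hfac' hG
    refine ⟨i, hci, fun S hSdef _ => ?_⟩
    dsimp only
    rw [if_neg hb0]
    by_cases hS0 : S = 0
    · rw [if_pos hS0]
      have h := omega_mul_add_lt 0 b.order.toNat (Nat.pos_of_ne_zero hνb)
      simpa using h
    · rw [if_neg hS0]
      exact omega_mul_add_lt _ _ (hS S hSdef hS0)

end Summit.ResolutionOfSingularities.ResolutionOfSingularities.Theorems
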